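import Summits.QuantumFields.YangMills.Theorems.IR.BlockedActivityCalibrationMesh
import Summits.QuantumFields.YangMills.Theorems.IR.BlockedActivityWTolerant
import Summits.QuantumFields.YangMills.Theorems.IR.Negative.TypShellCondFalseAllG
import Summits.QuantumFields.YangMills.Theorems.IR.Negative.OnsetMixingTypicalFalseOfMassWire
import HarnessLib

/-!
# Crux `IR` (stmt-QuantumFields-19354), lane B: the ACTIVITY-AXIS FLOOR at every fixed mesh, for every compact `G`

Helper module for item `stmt-QuantumFields-19354` (`--supports`; it closes nothing; route owner `ym-beyond-p2` g32, THE NUMBER §A‴ (6)).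

THE QUESTION (THE NUMBER §A‴, coupling of the scale axis §A″ to the activity axis).  The class of record of the activity axis is the
W-currency class `BlockedActivityClassW ρ β b n a` (p536391) and its `Typ`-relativisation `BlockedActivityTypW ∕ …TypWAll` (the conjunct of
the lane-B construction statements `BlockedActivityTypOnsetCalSCWTol ∕ …TolG`, p538172 ∕ p542635).  `Theorems/IR/BlockedActivityCalibrationMesh`
(p541588) certified the STRONG side at every mesh: `|β| · b⁴ ≤ κ ⇒ BlockedActivityClassW ρ β b n a`.  What does the tree's fixed-mesh negative
for format T (`Theorems/IR/Negative/TypShellCondFalseAllG`, every compact `G`) say about the class on the WEAK side?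

THE ANSWER (this file; cheap compositions of landed theorems, no new analysis).
* `radius_le_radiusKP` — bookkeeping: the Dobrushin radius `radius ε` (hence `radiusT ε`, `ε ≤ 1`) is below the KP radius `radiusKP ε`.
* **`not_blockedActivityTypW_stdFrame`** — for every compact second-countable `G`, continuous faithful unitary `ρ` of degree `N ≥ 1`, `k₀ ≠ 1`,
  mesh `b ≥ 1`, window `n`, budget `ε < 1`, radius `a ≤ radiusKP ε`, anchor budget `0 ≤ δ`, `4·#windowCellsPlus(n)·δ < 1`:
  `∃ β₀ ∀ β ≥ β₀ ∀ Typ, TypLocal (stdFrame b) Typ → ClauseIII ρ β (stdFrame b) b δ Typ → ¬ BlockedActivityTypW ρ β (stdFrame b) n a Typ`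
  (the lane's reduction `clauseI_of_blockedActivityTypW_sharp` feeds `FixedMeshAllG.frame_core_comb_clipped`; clause (ii) is NOT used).
* **`not_blockedActivityClassW_fixedMesh`** ∕ **`activityFloorW_allG`** — the plain class: `∃ β₀ ∀ β ≥ β₀, ¬ BlockedActivityClassW ρ β b n a`
  at every fixed mesh, uniformly on every bounded mesh range `1 ≤ b ≤ B` (`univShellCond_of_blockedActivityW_sharp` + `typShellCond_of_univShellCond`
  + `not_typShellCond_fixedMesh_allG'`).
* **`blockedActivityClassW_twoSided`** — THE TWO-SIDED PICTURE in the `(β, b)` plane at the radius of record `radiusKP ε` (`0 < ε < 1`): the class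
  HOLDS for `|β| · b⁴ ≤ κ` (p541588) and FAILS for `β ≥ β₁(B)` on `b ≤ B` — the W-onset mesh `b_W(β)` (least mesh inhabiting the class) is finite
  at strong coupling and DIVERGES as `β → ∞`, for EVERY non-trivial compact gauge group.
* **`not_tolGBlock_fixedMesh`** — the literal inner block of `BlockedActivityTypOnsetCalSCWTolG` (`TypLocal ∧ InsertionTolerant ∧ BlockedActivityTypWAll
  … (radiusT ε) ∧ ClauseIIukp ∧ ClauseIII`, quantified `∀ w, IsFrame b w → ∃ Typ, …`) FAILS at every FIXED mesh `b` for all large `β` once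
  `0 ≤ ε < 1` and `4·#windowCellsPlus(n)·δ < 1`: the statement's `∃ b` must choose `b = b(β) → ∞`, while its guard `a β · b < T` caps `b < T ∕ a(β)`;
  so the lane-B target is inhabitable only if the W|Typ-onset mesh is `O(ξ(β))` under `LowerBounds` — the kernel form of THE NUMBER §A‴ (6).

HONEST FRAMING: a floor (negative bookkeeping) for OPEN construction statements; nothing here constructs a representation at a growing mesh, proves
mixing, a gap, or anything about Clay.  No `sorry`; axioms ⊆ {propext, Classical.choice, Quot.sound}; no instances, no notation.
Refs: the cited tree files; KoteckyPreiss1986 (the radius); OsterwalderSeilerAnnPhys1978 §3 (strong side).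
-/

set_option autoImplicit false

noncomputable section

open MeasureTheory
open Literature.MathematicalPhysics.QuantumFieldTheory Literature.MathematicalPhysics.QuantumLattice
open Summit.QuantumFields.YangMills.Cruxes.IR.Tempered (cellEdges windowCells regionEdges)
open Summit.QuantumFields.YangMills.Cruxes.IR.ShellTempered (windowCellsPlus)
open Summit.QuantumFields.YangMills.Cruxes.IR.OnsetFormats (UnivShellCond TypShellCond)
open Summit.QuantumFields.YangMills.Cruxes.IR.AfPincerUc (IsFrame TypLocal ClauseIIukp ClauseIII)
open Summit.QuantumFields.YangMills.Cruxes.IR.AfPincerUc.SharpLanes (InsertionTolerant)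

namespace Summit.QuantumFields.YangMills.Cruxes.IR.BlockedActivity

/-! ## §0 Bookkeeping: the Dobrushin radius is below the KP radius -/

section Radii

variable {ε : ℝ}

/-- `radius ε = ε ∕ (4e·2⁸¹·(2e)⁸²) ≤ radiusKP ε = ε ∕ (13448 e²)` for `0 ≤ ε`. -/
theorem radius_le_radiusKP (hε : 0 ≤ ε) : radius ε ≤ radiusKP ε := by
  have he0 : 0 < Real.exp 1 := Real.exp_pos 1
  have he1 : 1 ≤ Real.exp 1 := by have := Real.add_one_le_exp (1 : ℝ); linarith
  have h2e : 1 ≤ 2 * Real.exp 1 := by linarith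
  have hK : (0 : ℝ) < 13448 * Real.exp 1 ^ 2 := by positivity
  have hKD : 13448 * Real.exp 1 ^ 2 ≤ radiusDen := by
    have hP : (2 * Real.exp 1) ^ 2 ≤ (2 * Real.exp 1) ^ 82 := pow_le_pow_right₀ h2e (by norm_num)
    have h3 : Real.exp 1 ^ 2 ≤ Real.exp 1 ^ 3 := by nlinarith [mul_nonneg (sub_nonneg.2 he1) (sq_nonneg (Real.exp 1))]
    unfold radiusDen
    calc 13448 * Real.exp 1 ^ 2 ≤ 4 * Real.exp 1 * 2 ^ 81 * (2 * Real.exp 1) ^ 2 := by nlinarith [sq_nonneg (Real.exp 1)]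
      _ ≤ 4 * Real.exp 1 * 2 ^ 81 * (2 * Real.exp 1) ^ 82 := by gcongr
  unfold radius radiusKP
  exact div_le_div_of_nonneg_left hε hK hKD

/-- `radiusT ε ≤ radiusKP ε` for `0 ≤ ε ≤ 1`. -/
theorem radiusT_le_radiusKP (hε : 0 ≤ ε) (hε1 : ε ≤ 1) : radiusT ε ≤ radiusKP ε := by
  rw [radiusT_eq_of_le_one hε1]; exact radius_le_radiusKP hε

end Radii

/-! ## §1 The Typ-relativised class at the standard frame: the floor at every fixed mesh -/

section Floor

variable {G : Type} [Group G] [TopologicalSpace G] [IsTopologicalGroup G] [CompactSpace G]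
  [SecondCountableTopology G] [MeasurableSpace G] [BorelSpace G]
  {N : ℕ} (ρ : G →* Matrix (Fin N) (Fin N) ℂ)

/-- **FLOOR FOR THE `Typ`-RELATIVISED CLASS (every compact `G`).**  At the standard mesh-`b` frame, for all large `β`, NO measurable cell-local
class `Typ` with the single-cell torus anchor `δ` (`ClauseIII`, budget `4·#windowCellsPlus(n)·δ < 1`) puts the kernels in `BlockedActivityTypW` at a
radius `a ≤ radiusKP ε`, `ε < 1`.  Clause (ii) is not used. -/
theorem not_blockedActivityTypW_stdFrame (hρ : Continuous ρ) (hρi : Function.Injective ρ)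
    (hρu : ∀ g, ρ g ∈ Matrix.unitaryGroup (Fin N) ℂ) (hN : 1 ≤ N) {k₀ : G} (hk₀ : k₀ ≠ 1)
    {b : ℕ} (hb : 1 ≤ b) (n : ℕ) {ε δ a : ℝ} (hε : ε < 1) (haε : a ≤ radiusKP ε)
    (hδ0 : 0 ≤ δ) (hδ : 4 * ((windowCellsPlus n).card : ℝ) * δ < 1) :
    ∃ β₀ : ℝ, ∀ β : ℝ, β₀ ≤ β → ∀ Typ : Cell → Set (LGConfig 4 G),
      TypLocal (FixedMesh.stdFrame b) Typ → ClauseIII ρ β (FixedMesh.stdFrame b) b δ Typ →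
        ¬ BlockedActivityTypW ρ β (FixedMesh.stdFrame b) n a Typ := by
  obtain ⟨β₀, hβ₀⟩ := FixedMeshAllG.frame_core_comb_clipped ρ hρ hρi hρu hN hk₀ hb n hε hδ0 hδ
  refine ⟨β₀, fun β hβ Typ hloc hIII hW => ?_⟩
  have hI : FixedMesh.ClauseI ρ β (FixedMesh.stdFrame b) n ε Typ := clauseI_of_blockedActivityTypW_sharp hW hε.le haε
  refine hβ₀ β hβ Typ hloc.1 hloc.2 (FixedMeshAllG.rowClauseI_of_clauseI hI) fun c hc => ?_
  have h := hIII ((2 * n + 2) * b + 1) (by nlinarith) {c} (Finset.singleton_nonempty c)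
    (fun c' hc' => by rw [Finset.mem_singleton] at hc'; subst hc'; exact FixedMesh.stdFrame_windowCellsPlus_bounds hc)
  simpa using h

/-- The same, uniformly on every bounded mesh range `1 ≤ b ≤ B`. -/
theorem activityFloorTypW_allG (hρ : Continuous ρ) (hρi : Function.Injective ρ)
    (hρu : ∀ g, ρ g ∈ Matrix.unitaryGroup (Fin N) ℂ) (hN : 1 ≤ N) {k₀ : G} (hk₀ : k₀ ≠ 1)
    (n : ℕ) {ε δ a : ℝ} (hε : ε < 1) (haε : a ≤ radiusKP ε)
    (hδ0 : 0 ≤ δ) (hδ : 4 * ((windowCellsPlus n).card : ℝ) * δ < 1) (B : ℕ) :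
    ∃ β₁ : ℝ, ∀ β : ℝ, β₁ ≤ β → ∀ b : ℕ, 1 ≤ b → b ≤ B → ∀ Typ : Cell → Set (LGConfig 4 G),
      TypLocal (FixedMesh.stdFrame b) Typ → ClauseIII ρ β (FixedMesh.stdFrame b) b δ Typ →
        ¬ BlockedActivityTypW ρ β (FixedMesh.stdFrame b) n a Typ := by
  induction B with
  | zero => exact ⟨0, fun β _ b hb hb0 => absurd hb (by omega)⟩
  | succ B ih =>
    obtain ⟨β₁, h₁⟩ := ih
    obtain ⟨β₀, h₀⟩ := not_blockedActivityTypW_stdFrame ρ hρ hρi hρu hN hk₀ (b := B + 1) (by omega) n hε haε hδ0 hδ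
    refine ⟨max β₁ β₀, fun β hβ b hb hbB => ?_⟩
    rcases Nat.lt_or_ge b (B + 1) with hlt | hge
    · exact h₁ β ((le_max_left _ _).trans hβ) b hb (by omega)
    · obtain rfl : b = B + 1 := le_antisymm hbB hge
      exact h₀ β ((le_max_right _ _).trans hβ)

/-! ## §2 The plain class `BlockedActivityClassW`: floor at every fixed mesh, and the two-sided picture -/

/-- **FLOOR FOR THE CLASS OF RECORD (every compact `G`).**  `BlockedActivityClassW ρ β b n a` (`a ≤ radiusKP ε`, `ε < 1`) fails at every fixed
mesh `b ≥ 1` and window `n` for all large `β`. -/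
theorem not_blockedActivityClassW_fixedMesh (hρ : Continuous ρ) (hρi : Function.Injective ρ)
    (hρu : ∀ g, ρ g ∈ Matrix.unitaryGroup (Fin N) ℂ) (hN : 1 ≤ N) {k₀ : G} (hk₀ : k₀ ≠ 1)
    {b : ℕ} (hb : 1 ≤ b) (n : ℕ) {ε a : ℝ} (hε : ε < 1) (haε : a ≤ radiusKP ε) :
    ∃ β₀ : ℝ, ∀ β : ℝ, β₀ ≤ β → ¬ BlockedActivityClassW ρ β b n a := by
  have hδ : 4 * ((windowCellsPlus n).card : ℝ) * 0 < 1 := by rw [mul_zero]; exact one_pos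
  obtain ⟨β₀, hβ₀⟩ := FixedMeshAllG.not_typShellCond_fixedMesh_allG' ρ hρ hρi hρu hN hk₀ hb n hε le_rfl hδ
  exact ⟨β₀, fun β hβ hW =>
    hβ₀ β hβ (OnsetFormats.typShellCond_of_univShellCond (univShellCond_of_blockedActivityW_sharp hW hε.le haε) 0)⟩

/-- **THE ACTIVITY-AXIS FLOOR, uniform on bounded mesh ranges (every compact `G`)**: for every `B` there is `β₁` beyond which NO mesh
`1 ≤ b ≤ B` inhabits the class — the W-onset mesh `b_W(β)` diverges. -/
theorem activityFloorW_allG (hρ : Continuous ρ) (hρi : Function.Injective ρ)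
    (hρu : ∀ g, ρ g ∈ Matrix.unitaryGroup (Fin N) ℂ) (hN : 1 ≤ N) {k₀ : G} (hk₀ : k₀ ≠ 1)
    (n : ℕ) {ε a : ℝ} (hε : ε < 1) (haε : a ≤ radiusKP ε) (B : ℕ) :
    ∃ β₁ : ℝ, ∀ β : ℝ, β₁ ≤ β → ∀ b : ℕ, 1 ≤ b → b ≤ B → ¬ BlockedActivityClassW ρ β b n a := by
  have hδ : 4 * ((windowCellsPlus n).card : ℝ) * 0 < 1 := by rw [mul_zero]; exact one_pos
  obtain ⟨β₁, hβ₁⟩ := FixedMeshAllG.typOnsetFloor_allG' ρ hρ hρi hρu hN hk₀ n hε le_rfl hδ B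
  exact ⟨β₁, fun β hβ b hb hbB hW =>
    hβ₁ β hβ b hb hbB (OnsetFormats.typShellCond_of_univShellCond (univShellCond_of_blockedActivityW_sharp hW hε.le haε) 0)⟩

/-- **THE TWO-SIDED PICTURE at the radius of record `radiusKP ε`, `0 < ε < 1` (every non-trivial compact `G`, faithful unitary `ρ`).**
STRONG SIDE (p541588): one `κ > 0` with the class at every mesh `b ≥ 1`, every `|β|·b⁴ ≤ κ`, every window.  WEAK SIDE (this file): for every
window `n` and mesh bound `B`, a `β₁` beyond which no mesh `≤ B` inhabits the class.  Hence `b_W(β) < ∞` for `|β| ≤ κ` and `b_W(β) → ∞`. -/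
theorem blockedActivityClassW_twoSided (hρ : Continuous ρ) (hρi : Function.Injective ρ)
    (hρu : ∀ g, ρ g ∈ Matrix.unitaryGroup (Fin N) ℂ) (hN : 1 ≤ N) {k₀ : G} (hk₀ : k₀ ≠ 1)
    {ε : ℝ} (hε0 : 0 < ε) (hε : ε < 1) :
    (∃ κ : ℝ, 0 < κ ∧ ∀ b : ℕ, 1 ≤ b → ∀ β : ℝ, |β| * (b : ℝ) ^ 4 ≤ κ → ∀ n : ℕ, BlockedActivityClassW ρ β b n (radiusKP ε)) ∧
    (∀ n B : ℕ, ∃ β₁ : ℝ, ∀ β : ℝ, β₁ ≤ β → ∀ b : ℕ, 1 ≤ b → b ≤ B → ¬ BlockedActivityClassW ρ β b n (radiusKP ε)) :=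
  ⟨blockedActivityClassW_of_beta_mul_pow_four_le ρ hρ (radiusKP_pos hε0),
    fun n B => activityFloorW_allG ρ hρ hρi hρu hN hk₀ n hε le_rfl B⟩

/-! ## §3 The literal inner block of `BlockedActivityTypOnsetCalSCWTolG` fails at every fixed mesh -/

/-- **THE LANE-B TARGET'S BLOCK AT A FIXED MESH (every compact `G`).**  For `0 ≤ ε < 1`, `0 ≤ δ`, `4·#windowCellsPlus(n)·δ < 1`, every
`θ R ℓ₀`, and every fixed mesh `b ≥ 1`: for all large `β` it is FALSE that every mesh-`b` frame carries a `Typ` with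
`TypLocal ∧ InsertionTolerant ∧ BlockedActivityTypWAll … (radiusT ε) ∧ ClauseIIukp ∧ ClauseIII` (only the standard frame, centre `0`, the W|Typ
conjunct and the anchor are used).  So the `∃ b` of `…TolG` is forced to diverge with `β`, against its cap `a β · b < T`. -/
theorem not_tolGBlock_fixedMesh (hρ : Continuous ρ) (hρi : Function.Injective ρ)
    (hρu : ∀ g, ρ g ∈ Matrix.unitaryGroup (Fin N) ℂ) (hN : 1 ≤ N) {k₀ : G} (hk₀ : k₀ ≠ 1)
    {b : ℕ} (hb : 1 ≤ b) (n : ℕ) {ε δ : ℝ} (hε0 : 0 ≤ ε) (hε : ε < 1)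
    (hδ0 : 0 ≤ δ) (hδ : 4 * ((windowCellsPlus n).card : ℝ) * δ < 1) (θ : ℝ) (R ℓ₀ : ℕ) :
    ∃ β₀ : ℝ, ∀ β : ℝ, β₀ ≤ β →
      ¬ (∀ w : Fin 4 → ℤ → ℤ, IsFrame b w → ∃ Typ : (Fin 4 → ℤ) → Set (LGConfig 4 G),
          TypLocal w Typ ∧ InsertionTolerant ρ w θ R ℓ₀ Typ ∧ BlockedActivityTypWAll ρ β w n (radiusT ε) Typ ∧
            ClauseIIukp ρ β w δ Typ ∧ ClauseIII ρ β w b δ Typ) := by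
  obtain ⟨β₀, hβ₀⟩ := not_blockedActivityTypW_stdFrame ρ hρ hρi hρu hN hk₀ hb n hε (radiusT_le_radiusKP hε0 hε.le) hδ0 hδ
  refine ⟨β₀, fun β hβ hblock => ?_⟩
  obtain ⟨Typ, hloc, -, hAll, -, hIII⟩ := hblock (FixedMesh.stdFrame b) (FixedMesh.stdFrame_admissible b)
  have h0 := hAll 0
  simp only [OnsetFormatsUc.shiftFrame_zero, add_zero] at h0
  exact hβ₀ β hβ Typ hloc hIII h0

/-- The same floor, uniform on bounded mesh ranges: for every `B` a `β₁` beyond which the block fails at EVERY mesh `1 ≤ b ≤ B`. -/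
theorem tolGBlock_floor_allG (hρ : Continuous ρ) (hρi : Function.Injective ρ)
    (hρu : ∀ g, ρ g ∈ Matrix.unitaryGroup (Fin N) ℂ) (hN : 1 ≤ N) {k₀ : G} (hk₀ : k₀ ≠ 1)
    (n : ℕ) {ε δ : ℝ} (hε0 : 0 ≤ ε) (hε : ε < 1)
    (hδ0 : 0 ≤ δ) (hδ : 4 * ((windowCellsPlus n).card : ℝ) * δ < 1) (θ : ℝ) (R ℓ₀ : ℕ) (B : ℕ) :
    ∃ β₁ : ℝ, ∀ β : ℝ, β₁ ≤ β → ∀ b : ℕ, 1 ≤ b → b ≤ B →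
      ¬ (∀ w : Fin 4 → ℤ → ℤ, IsFrame b w → ∃ Typ : (Fin 4 → ℤ) → Set (LGConfig 4 G),
          TypLocal w Typ ∧ InsertionTolerant ρ w θ R ℓ₀ Typ ∧ BlockedActivityTypWAll ρ β w n (radiusT ε) Typ ∧
            ClauseIIukp ρ β w δ Typ ∧ ClauseIII ρ β w b δ Typ) := by
  induction B with
  | zero => exact ⟨0, fun β _ b hb hb0 => absurd hb (by omega)⟩
  | succ B ih =>
    obtain ⟨β₁, h₁⟩ := ih
    obtain ⟨β₀, h₀⟩ := not_tolGBlock_fixedMesh ρ hρ hρi hρu hN hk₀ (b := B + 1) (by omega) n hε0 hε hδ0 hδ θ R ℓ₀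
    refine ⟨max β₁ β₀, fun β hβ b hb hbB => ?_⟩
    rcases Nat.lt_or_ge b (B + 1) with hlt | hge
    · exact h₁ β ((le_max_left _ _).trans hβ) b hb (by omega)
    · obtain rfl : b = B + 1 := le_antisymm hbB hge
      exact h₀ β ((le_max_right _ _).trans hβ)

end Floor

end Summit.QuantumFields.YangMills.Cruxes.IR.BlockedActivity

end
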